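import Summits.MatrixMultiplication.OmegaCensus.STPPVosperTableRatio
import Summits.MatrixMultiplication.OmegaCensus.STPP222SqSymmetry
import Summits.MatrixMultiplication.OmegaCensus.STPPDisjointPacking

/-!
# ω-census (abelian STPP census): a double Vosper clash at `ℤ₆₁` in the readings `(a,c,b)` and `(c,a,b)` — {(1,1,2),(2,5,3),(2,5,3)} (kernel)

HONEST FRAMING (pub-omega census; verbatim): lottery ticket; floor = certified bounds/negative ranges.
Census STRUCTURE (seat pub-omega-stpp-1 gen 29, 2026-08-28), family (b2).  EXCLUDES the minimal beating pattern `{(1,1,2),(2,5,3),(2,5,3)}` of `ℤ₆₁`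
(`Σ aᵢbᵢcᵢ = 2 + 30 + 30 = 62`), alive under the python filters N7–N20 and under the single Vosper tables; nothing here is progress on `ω`.

## Proof (`no_isSTPP_zmod61_112_253_253`)

Block 3 `= (2,5,3)` is N18-tight in two role readings that pair `A₃` with `C₃`:
* `(a,c,b)` — the family `(−A, −C, −B)` (`STPP222SqNeg.isSTPP_negSwap`): `11 + 3 + 30 + 2 + 17 = 63`; `tight_ratio_val_mem` with the table `(48, 18, 3)`
  gives `−A₃ = {α₁, α₁ + e₁}`, `−C₃` a 3-progression of step `e₁′`, `e₁/e₁′ ∈ {±1, ±30}` (`table_48_18_3`);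
* `(c,a,b)` — the family `(C, A, B)` (`stpp_rotate` twice): `17 + 2 + 30 + 3 + 11 = 63`; the table `(43, 13, 2)` gives `C₃` a 3-progression of step `e₂`,
  `A₃ = {β₂, β₂ + e₂′}`, `e₂/e₂′ ∈ {±1, ±3, ±30}` (`table_43_13_2`).
The steps of `A₃` and of `C₃` agree up to sign across the readings (`step_eq_or_eq_neg_of_apFinset_two_eq`, `eq_or_eq_neg_of_mutual_apFinset_subset`), so
`e₁² = e₂′²`, `e₁′² = e₂²`; with `e₁² ∈ {1, 46}·e₁′²` and `e₂² ∈ {1, 9, 46}·e₂′²` this forces `(D₁D₂ − 1)·e₂′² = 0` with `D₁D₂ − 1 ∈ {0, 8, 45, 413, 2115}`: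
the nonzero coefficients (`≢ 0 mod 61`) contradict `e₂′ ≠ 0`, and `D₁ = D₂ = 1` means `e₂′ = ±e₂`, which breaks the TPP of block 3 through the pair `(A₃, C₃)`
(word `(s′ − s) + (t − t) + (u′ − u) = 0` at `(3,3,3)`).  Python cross-readings: `code/p6_tables.py`, `code/p7_multi.py`, `code/p8_pairs.py` (HOME gen-29 dir).

References: A. G. Vosper, J. London Math. Soc. 31 (1956); M. B. Nathanson, *Additive Number Theory: Inverse Problems*, GTM 165, Thm 2.7; H. Cohn,
R. Kleinberg, B. Szegedy, C. Umans, FOCS 2005 (arXiv:math/0511460), Def. 5.1.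
-/

open Finset
open scoped Pointwise

namespace Summit.MatrixMultiplication.OmegaCensus.CubeNB

open Literature.Computability.AlgebraicComplexity
open Literature.Combinatorics.Additive
open Summit.MatrixMultiplication.OmegaCensus.STPPKneser

/-- Table `(48, 18, 3)`: survivors `{0, 1, 60, 30, 31}`. [folklore] -/
theorem table_48_18_3 : ∀ j < 61, ∀ t < 61, (∀ i < 18, (t + j * i) % 61 < 48) →
    (∀ k < 18, 3 ∣ (t + j * k) % 61 - #((range 18).filter fun i => (t + j * i) % 61 < (t + j * k) % 61)) →
    j ∈ ({0, 1, 60, 30, 31} : Finset ℕ) := by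
  decide +kernel

/-- Table `(43, 13, 2)`: survivors `{0, 1, 60, 3, 58, 30, 31}`. [folklore] -/
theorem table_43_13_2 : ∀ j < 61, ∀ t < 61, (∀ i < 13, (t + j * i) % 61 < 43) →
    (∀ k < 13, 2 ∣ (t + j * k) % 61 - #((range 13).filter fun i => (t + j * i) % 61 < (t + j * k) % 61)) →
    j ∈ ({0, 1, 60, 3, 58, 30, 31} : Finset ℕ) := by
  decide +kernel

/-- **`{(1,1,2),(2,5,3),(2,5,3)}` has no STPP family in `ℤ₆₁`** (double Vosper clash in the readings `(a,c,b)` and `(c,a,b)` at the block `(2,5,3)`; see the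
module docstring). [cite: CohnKleinbergSzegedyUmans2005, Def. 5.1] [cite: Nathanson1996, Thm 2.7] -/
theorem no_isSTPP_zmod61_112_253_253 (A B C : Fin 3 → Finset (ZMod 61)) (hS : IsSTPP A B C)
    (hA : ∀ i, #(A i) = ![1, 2, 2] i) (hB : ∀ i, #(B i) = ![1, 5, 5] i) (hC : ∀ i, #(C i) = ![2, 3, 3] i) : False := by
  have k8 : (8 : ZMod 61) ≠ 0 := by decide
  have k45 : (45 : ZMod 61) ≠ 0 := by decide
  have k413 : (413 : ZMod 61) ≠ 0 := by decide
  have k2115 : (2115 : ZMod 61) ≠ 0 := by decide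
  have h61 : (61 : ZMod 61) = 0 := by decide
  have h60 : ((60 : ℕ) : ZMod 61) = -1 := by decide
  haveI : Fact (Nat.Prime 61) := ⟨prime_61⟩
  have hAne : ∀ i, (A i).Nonempty := fun i => card_pos.1 (by rw [hA]; fin_cases i <;> simp)
  have hBne : ∀ i, (B i).Nonempty := fun i => card_pos.1 (by rw [hB]; fin_cases i <;> simp)
  have hCne : ∀ i, (C i).Nonempty := fun i => card_pos.1 (by rw [hC]; fin_cases i <;> simp)
  have e2 : (univ : Finset (Fin 3)).erase 2 = {0, 1} := by decide
  have hI : ((univ : Finset (Fin 3)).erase 2).Nonempty := ⟨0, by decide⟩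
  -- Reading (a,c,b): the family (−A, −C, −B), tight block 2 = (2,3,5)
  set A' : Fin 3 → Finset (ZMod 61) := fun t => (A t).image Neg.neg with hA'
  set B' : Fin 3 → Finset (ZMod 61) := fun t => (C t).image Neg.neg with hB'
  set C' : Fin 3 → Finset (ZMod 61) := fun t => (B t).image Neg.neg with hC'
  have hS' : IsSTPP A' B' C' := STPP222SqNeg.isSTPP_negSwap hS
  have hcA' : ∀ t, #(A' t) = #(A t) := fun t => Finset.card_image_of_injective _ neg_injective
  have hcB' : ∀ t, #(B' t) = #(C t) := fun t => Finset.card_image_of_injective _ neg_injective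
  have hcC' : ∀ t, #(C' t) = #(B t) := fun t => Finset.card_image_of_injective _ neg_injective
  have hz1 : ∑ k ∈ (univ : Finset (Fin 3)).erase 2, #(A' k) * #(C' k) = 11 := by
    rw [e2, Finset.sum_pair (by decide)]; simp [hcA', hcC', hA, hB]
  have hL1 : ∑ k ∈ (univ : Finset (Fin 3)).erase 2, #(B' k) * #(C' k) = 17 := by
    rw [e2, Finset.sum_pair (by decide)]; simp [hcB', hcC', hB, hC]
  have ha1 : #(A' 2) = 2 := by rw [hcA', hA]; simp
  have hb1 : #(B' 2) = 3 := by rw [hcB', hC]; simp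
  have hvol1 : #(A' 2) * #(B' 2) * #(C' 2) = 30 := by rw [hcA', hcB', hcC', hA, hB, hC]; simp
  obtain ⟨e₁, e₁', α₁, β₁, he₁, he₁', hα₁, hβ₁, hr1⟩ := tight_ratio_val_mem A' B' C' hS' (fun t => (hAne t).image _)
    (fun t => (hCne t).image _) (fun t => (hBne t).image _) 2 hI ha1 hb1 hvol1 hz1 hL1 (by norm_num) (by norm_num) (by norm_num)
    (by norm_num) (by norm_num) (m := 18) (n := 48) rfl rfl table_48_18_3
  -- Reading (c,a,b): the family (C, A, B), tight block 2 = (3,2,5)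
  have hS'' : IsSTPP C A B := stpp_rotate (stpp_rotate hS)
  have hz2 : ∑ k ∈ (univ : Finset (Fin 3)).erase 2, #(C k) * #(B k) = 17 := by
    rw [e2, Finset.sum_pair (by decide)]; simp [hB, hC]
  have hL2 : ∑ k ∈ (univ : Finset (Fin 3)).erase 2, #(A k) * #(B k) = 11 := by
    rw [e2, Finset.sum_pair (by decide)]; simp [hA, hB]
  have ha2 : #(C 2) = 3 := by rw [hC]; simp
  have hb2 : #(A 2) = 2 := by rw [hA]; simp
  have hvol2 : #(C 2) * #(A 2) * #(B 2) = 30 := by rw [hA, hB, hC]; simp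
  obtain ⟨e₂, e₂', α₂, β₂, he₂, he₂', hα₂, hβ₂, hr2⟩ := tight_ratio_val_mem C A B hS'' hCne hAne hBne 2 hI ha2 hb2 hvol2 hz2 hL2
    (by norm_num) (by norm_num) (by norm_num) (by norm_num) (by norm_num) (m := 13) (n := 43) rfl rfl table_43_13_2
  -- the steps of A₃ and of C₃ agree up to sign across the readings
  have hIA : e₁ ^ 2 = e₂' ^ 2 := by
    have hneg : A' 2 = -(A 2) := rfl
    rw [hβ₂, neg_apFinset, hα₁] at hneg
    rcases step_eq_or_eq_neg_of_apFinset_two_eq he₂' hneg with h | h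
    · rw [h]
    · rw [h]; ring
  have hIC : e₁' ^ 2 = e₂ ^ 2 := by
    have hneg : B' 2 = -(C 2) := rfl
    rw [hα₂, neg_apFinset, hβ₁] at hneg
    -- hneg : apFinset β₁ e₁' 3 = apFinset (−α₂ − 2•e₂) e₂ 3
    rcases eq_or_eq_neg_of_mutual_apFinset_subset he₁' he₂ (by norm_num) (by norm_num) hneg.le hneg.symm.le (by norm_num) with h | h
    · rw [h]
    · rw [h]; ring
  -- the word of block 3 through the pair (A₃, C₃)
  obtain ⟨b, hb⟩ := hBne 2
  have hsA : β₂ ∈ A 2 := by rw [hβ₂]; exact mem_apFinset.2 ⟨0, by norm_num, by simp⟩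
  have hsA' : β₂ + e₂' ∈ A 2 := by rw [hβ₂]; exact mem_apFinset.2 ⟨1, by norm_num, by simp⟩
  have huC : α₂ ∈ C 2 := by rw [hα₂]; exact mem_apFinset.2 ⟨0, by norm_num, by simp⟩
  have huC' : α₂ + e₂ ∈ C 2 := by rw [hα₂]; exact mem_apFinset.2 ⟨1, by norm_num, by simp⟩
  have hAC : ¬ (e₂' = e₂ ∨ e₂' = -e₂) := by
    rintro (h | h)
    · have hrel : ((β₂ + e₂') - β₂) + (b - b) + (α₂ - (α₂ + e₂)) = 0 := by rw [h]; ring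
      obtain ⟨-, -, h3, -, -⟩ := hS 2 2 2 β₂ hsA (β₂ + e₂') hsA' b hb b hb (α₂ + e₂) huC' α₂ huC hrel
      exact he₂' (by linear_combination h3.symm)
    · have hrel : ((β₂ + e₂') - β₂) + (b - b) + ((α₂ + e₂) - α₂) = 0 := by rw [h]; ring
      obtain ⟨-, -, h3, -, -⟩ := hS 2 2 2 β₂ hsA (β₂ + e₂') hsA' b hb b hb α₂ huC (α₂ + e₂) huC' hrel
      exact he₂' (by linear_combination h3.symm)
  -- ratio values to equations between squares
  have key : ∀ {x x' : ZMod 61}, x' ≠ 0 → ∀ d : ℕ, (x'⁻¹ * x).val = d → x = ((d : ℕ) : ZMod 61) * x' := by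
    intro x x' hx' d hd
    have hxx : x' * (x'⁻¹ * x) = x := by rw [← mul_assoc, mul_inv_cancel₀ hx', one_mul]
    rw [← hxx, ← hd, ZMod.natCast_zmod_val, mul_comm]
  have hD1 : e₁ ^ 2 = e₁' ^ 2 ∨ e₁ ^ 2 = 46 * e₁' ^ 2 := by
    simp only [Finset.mem_insert, Finset.mem_singleton] at hr1
    rcases hr1 with h | h | h | h | h
    · exact absurd ((ZMod.val_eq_zero _).1 h) (mul_ne_zero (inv_ne_zero he₁') he₁)
    · left; rw [key he₁' 1 h, Nat.cast_one, one_mul]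
    · left; rw [key he₁' 60 h, h60]; ring
    · right; rw [key he₁' 30 h]; push_cast; linear_combination (14 * e₁' ^ 2) * h61
    · right; rw [key he₁' 31 h]; push_cast; linear_combination (15 * e₁' ^ 2) * h61
  have hD2 : e₂ ^ 2 = e₂' ^ 2 ∨ e₂ ^ 2 = 9 * e₂' ^ 2 ∨ e₂ ^ 2 = 46 * e₂' ^ 2 := by
    simp only [Finset.mem_insert, Finset.mem_singleton] at hr2
    rcases hr2 with h | h | h | h | h | h | h
    · exact absurd ((ZMod.val_eq_zero _).1 h) (mul_ne_zero (inv_ne_zero he₂') he₂)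
    · left; rw [key he₂' 1 h, Nat.cast_one, one_mul]
    · left; rw [key he₂' 60 h, h60]; ring
    · right; left; rw [key he₂' 3 h]; push_cast; ring
    · right; left; rw [key he₂' 58 h]; push_cast; linear_combination (55 * e₂' ^ 2) * h61
    · right; right; rw [key he₂' 30 h]; push_cast; linear_combination (14 * e₂' ^ 2) * h61
    · right; right; rw [key he₂' 31 h]; push_cast; linear_combination (15 * e₂' ^ 2) * h61
  have kill : ∀ K : ZMod 61, K ≠ 0 → K * e₂' ^ 2 = 0 → False := fun K hK h =>
    he₂' (pow_eq_zero_iff (n := 2) (by norm_num) |>.1 ((mul_eq_zero.1 h).resolve_left hK))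
  rcases hD1 with hD1c | hD1c <;> rcases hD2 with hD2c | hD2c | hD2c
  · -- D₁ = D₂ = 1: e₂′² = e₂²
    have hsq : e₂' ^ 2 = e₂ ^ 2 := by linear_combination hD1c + hIC - hIA
    have h0 : (e₂' - e₂) * (e₂' + e₂) = 0 := by linear_combination hsq
    rcases mul_eq_zero.1 h0 with h1 | h1
    · exact hAC (Or.inl (by linear_combination h1))
    · exact hAC (Or.inr (by linear_combination h1))
  · exact kill 8 k8 (by linear_combination (-1 : ZMod 61) * hD2c - hIC - hD1c + hIA)
  · exact kill 45 k45 (by linear_combination (-1 : ZMod 61) * hD2c - hIC - hD1c + hIA)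
  · exact kill 45 k45 (by linear_combination (-46 : ZMod 61) * hD2c - 46 * hIC - hD1c + hIA)
  · exact kill 413 k413 (by linear_combination (-46 : ZMod 61) * hD2c - 46 * hIC - hD1c + hIA)
  · exact kill 2115 k2115 (by linear_combination (-46 : ZMod 61) * hD2c - 46 * hIC - hD1c + hIA)

end Summit.MatrixMultiplication.OmegaCensus.CubeNB
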